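import Literature.NumberTheory.EllipticCurves.LambdaAdicSelmerDataToEisensteinH1Linear
import Literature.NumberTheory.EllipticCurves.ZpExtensionEisensteinTwistCoresUnramified
import Literature.NumberTheory.EllipticCurves.KodairaNeronUnramifiedInertiaProofs
import Literature.NumberTheory.EllipticCurves.SubgroupSelmerCocycleCriteriaProofs
import Literature.NumberTheory.GaloisRepresentations.MaxUnramifiedIntegers
import Literature.NumberTheory.GaloisRepresentations.GaloisCohomologyInfResProofs
import HarnessLib

/-!
# The compact control map `𝔖_p(K_∞) → H¹(K, T_𝔮)` lands in classes UNRAMIFIED at the good places `v ∤ p`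

Topic `NumberTheory/EllipticCurves`; namespaces `Literature.NumberTheory.GaloisRepresentations.IsNonarchimedeanLocalField`
(§1), `IsDedekindDomain.HeightOneSpectrum` (§1), `Literature.NumberTheory.EllipticCurves.ZpExtension` (§2), `WeierstrassCurve`
(§3), `WeierstrassCurve.LambdaAdicSelmerData` (§4).
THEOREMS ONLY (no definition, no named fact, no instance, no `sorry`).

Setting: `E/K` an elliptic curve over a number field (`V : WeierstrassCurve K`), `K_∞/K` a `ℤ_p`-extension
(`κ : ZpExtension K p`), `𝔖 = 𝔖_p(K_∞)` Perrin-Riou's compact Selmer module (`D : V.LambdaAdicSelmerData κ γ`,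
components `D.proj n s k ∈ Sel^{(p^k)}(E/K_n) ⊆ H¹(Γ_n, E[p^k])`), and Howard's twisted coefficients
`T_𝔮/p^k = E[p^k] ⊗ A_{m,k}` (`κ⁻.eisensteinTwist`, `κ⁻ = κ.unitTwist (-1)`) with the compact control map
`toEisensteinH1Linear : 𝔖 →ₗ[Λ] H¹(K, T_𝔮)` (`LambdaAdicSelmerDataToEisensteinH1Linear`), whose `k`-th projection
is `cor_{Γ_n}^{Γ_K} ((1 ⊗ ·)_* (D.proj n s k))` (`eisensteinComponent`, `proj_toEisensteinH1Linear`).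

What is proved (Silverman X.4.2(b)/Cor. X.4.4 for the LAYERS of the tower, then corestriction):

* §1 `absGaloisRestrict_maxUnramified_mem_absInertia` — `Γ_{F^{nr}} → Γ_F` lands in the inertia group `I_F`
  (universe-polymorphic form of `HomDualUnramifiedSplitting.absGaloisRestrict_mem_galUnr`, which is stated for
  `F : Type`); at a finite place `v` of a number field, in `𝔐.inertia Γ_{K_v}` for the prime `𝔐` of `\bar 𝓞_v`
  (`absGaloisRestrict_maxUnramified_mem_inertia`).
* §2 `ZpExtension.map_comapRestrict_oneCocycleClass_eq_zero_of_forall_apply_eq_zero` — a class of `H¹(N, M)` whose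
  cocycle vanishes on `φ⁻¹N` dies along the restricted pair `(φ|, id_M)` (generic discrete `Γ_K`-module).
* §3 `localResTorsionOverOfEmb_conjH1_eq_zero_of_mem_selmerTorsionOver` — unpacking the Selmer condition of
  `Sel^{(m)}(E/K̄^H)` at `(v, g)`; `cocycle_apply_eq_zero_of_localResTorsionOverOfEmb_eq_zero` — a cocycle of a
  class of `H¹(H, E[m])` satisfying the local (Kummer) condition at `v` VANISHES at every `res τ ∈ H`, `τ ∈ I_{K_v}`,
  when `v` is good and `v ∤ m` (Silverman's "`n(P^σ - P) = O ⇒ P^σ = P`", the tree's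
  `smul_localPoints_eq_of_mem_inertia_holds`); `map_comapRestrict_unramifiedRestrictHom_eq_zero` — hence the class dies
  on `Γ_{(K_v)^{nr}} ×_{Γ_K} H` (the currency of `ZpExtension.res_coresEisenstein_mem_unramifiedSubgroup`).
* §4 `proj_conjMap_unramified` — every conjugate `g · (D.proj n s k)` dies on `Γ_{(K_v)^{nr}} ×_{Γ_K} Γ_n` for good
  `v ∤ p`; **`localization_eisensteinComponent_mem_unramifiedSubgroup`**,
  **`localization_proj_toEisensteinH1Linear_mem_unramifiedSubgroup`** — the localisation at a good `v ∤ p` of every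
  projection of `toEisensteinH1Linear s` lies in `H¹_{ur}(K_v, T_𝔮/p^k)`: verbatim the hypothesis `(ur)` of
  `ZpExtension.EisensteinH1Data.mem_ordinarySelmer_of_local` (`ZpExtensionEisensteinSelmerLocalCriterion`) for the
  image of `𝔖`, at every finite `v` outside `badPlaces ∪ {v ∣ p}`.

References: Silverman, *AEC* (2009), X.§4, proof of Thm. 4.2(b) and Cor. 4.4; Howard, *Compos. Math.* 140 (2004),
§2.1–§2.2 (the Selmer structure `F_𝔮` is unramified outside `Σ`; `𝔖 → H¹_{F}(K, T_𝔮)`), Lemma 2.2.7; Serre,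
*Local Fields*, IV §4 (inertia = `Gal(F̄/F^{nr})`); Neukirch–Schmidt–Wingberg (2008), I §5 (corestriction).
No summit statement is proved here.
-/

noncomputable section

open scoped TensorProduct Topology ContRepresentation Classical NumberField
open Field CategoryTheory NumberField IsDedekindDomain
open Literature.NumberTheory.GaloisRepresentations Literature.NumberTheory.EllipticCurves
open Literature.NumberTheory.GaloisRepresentations.DiscreteGaloisModule (unramifiedSubgroup)
open Literature.NumberTheory.EllipticCurves.ZpExtension (eisensteinLevel)

universe u

/-! ## §1 `Γ_{F^{nr}} → Γ_F` lands in the inertia group -/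

namespace Literature.NumberTheory.GaloisRepresentations.IsNonarchimedeanLocalField

variable (F : Type u) [Field F] [ValuativeRel F] [TopologicalSpace F] [IsNonarchimedeanLocalField F]

/-- **`res (Γ_{F^{nr}}) ⊆ I_F`**: the restriction to `F̄` of an automorphism of `\overline{F^{nr}}` over
`F^{nr} = maxUnramified F` fixes `F^{nr}` pointwise (`F^{nr}/F` is normal, being `Γ_F`-stable:
`smul_mem_maxUnramified`), hence lies in `I_F = Gal(F̄/F^{nr})` (`mem_absInertia_iff_forall_mem_maxUnramified`).
Universe-polymorphic form of `HomDualUnramifiedSplitting.absGaloisRestrict_mem_galUnr` (stated for `F : Type`).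
[cite: SerreLocalFields1979, Ch. IV §4 Cor. 2 to Prop. 16] -/
theorem absGaloisRestrict_maxUnramified_mem_absInertia (σ : absoluteGaloisGroup (maxUnramified F)) :
    absGaloisRestrict F (maxUnramified F) σ ∈ absInertia F := by
  -- adapted from `HomDualUnramifiedSplitting.normal_maxUnramified` / `absGaloisRestrict_mem_galUnr` (`F : Type` there)
  haveI : Normal F (maxUnramified F) := by
    rw [IntermediateField.normal_iff_forall_map_le']
    intro τ x hx
    obtain ⟨y, hy, rfl⟩ := (IntermediateField.mem_map _).1 hx
    have h := smul_mem_maxUnramified ((absoluteGaloisGroup.toAlgEquiv F).symm τ) hy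
    rwa [absoluteGaloisGroup.smul_def, MulEquiv.apply_symm_apply] at h
  rw [mem_absInertia_iff_forall_mem_maxUnramified]
  exact (mem_absGaloisFixingSubgroup_iff (maxUnramified F) _).1
    (absGaloisRestrict_mem_absGaloisFixingSubgroup F (maxUnramified F) σ)

end Literature.NumberTheory.GaloisRepresentations.IsNonarchimedeanLocalField

namespace IsDedekindDomain.HeightOneSpectrum

variable {K : Type u} [Field K] [NumberField K] (v : HeightOneSpectrum (𝓞 K))

/-- **`res (Γ_{(K_v)^{nr}}) ⊆ I_𝔐`** for the prime `𝔐` of the local absolute integers `\bar 𝓞_v` above `𝓂_v`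
(`𝔐.inertia Γ_{K_v} = absInertia K_v`, `inertia_eq_absInertia`). [cite: SerreLocalFields1979, Ch. IV §4 Cor. 2 to Prop. 16]
[cite: NeukirchANT1999, Ch. II (9.3)] -/
theorem absGaloisRestrict_maxUnramified_mem_inertia {𝔐 : Ideal v.localAbsIntegers} (h𝔐 : 𝔐 ∈ v.localPrimesAbove)
    (σ : absoluteGaloisGroup (IsNonarchimedeanLocalField.maxUnramified (v.adicCompletion K))) :
    absGaloisRestrict (v.adicCompletion K) (IsNonarchimedeanLocalField.maxUnramified (v.adicCompletion K)) σ ∈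
      𝔐.inertia (absoluteGaloisGroup (v.adicCompletion K)) := by
  obtain ⟨w, hw⟩ := v.exists_spectralValuation
  rw [inertia_eq_absInertia hw h𝔐]
  exact IsNonarchimedeanLocalField.absGaloisRestrict_maxUnramified_mem_absInertia _ σ

end IsDedekindDomain.HeightOneSpectrum

/-! ## §2 A class whose cocycle vanishes on `φ⁻¹N` dies along the restricted pair `(φ|, id)` -/

namespace Literature.NumberTheory.EllipticCurves.ZpExtension

variable {K : Type u} [Field K] {M : Type u} [AddCommGroup M] [TopologicalSpace M] [DiscreteTopology M]
  {L : Type u} [Field L]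

/-- **A cocycle vanishing on `φ⁻¹N` gives the zero class of `H¹(φ⁻¹N, M)`** along the restricted compatible pair
`(φ| : φ⁻¹N → N, id_M)` (`comapRestrict`, `resPairHom`, `idPairHom`): `H¹(φ|, id) [z] = [z ∘ φ|] = [0] = 0`.
(Generic in the discrete `Γ_K`-module `ρ`; the hypothesis form of `pullback_coresEisenstein_eq_zero'` /
`res_coresEisenstein_mem_unramifiedSubgroup`.) [cite: SerreLocalFields1979, VII §5] [cite: NeukirchSchmidtWingberg2008, I §5] -/
theorem map_comapRestrict_oneCocycleClass_eq_zero_of_forall_apply_eq_zero (ρ : DiscreteGaloisModule K M)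
    (φ : absoluteGaloisGroup L →ₜ* absoluteGaloisGroup K) (N : Subgroup (absoluteGaloisGroup K))
    (z : contOneCocycles (subgroupRep ρ.toTopRep N))
    (hz : ∀ h : N.comap (φ : absoluteGaloisGroup L →* absoluteGaloisGroup K), z.1 (comapRestrict N φ h) = 0) :
    ContinuousCohomology.map (comapRestrict N φ)
        (resPairHom ρ.toTopRep (DiscreteGaloisModule.toTopRep (ContinuousRep.restrict ρ φ)) φ (idPairHom ρ φ) N) 1
        (oneCocycleClass _ z) = 0 := by
  rw [map_pair_oneCocycleClass]
  refine (congrArg (oneCocycleClass _) (Subtype.ext (ContinuousMap.ext fun h ↦ ?_))).trans (oneCocycleClass_zero _)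
  rw [contOneCocycles.pullback_apply, resPairHom_hom_apply, idPairHom_hom_apply, hz]
  rfl

end Literature.NumberTheory.EllipticCurves.ZpExtension

/-! ## §3 Kummer classes of `H¹(H, E[m])` vanish on inertia above a good place `v ∤ m` -/

namespace WeierstrassCurve

variable {K : Type u} [Field K] [NumberField K] (V : WeierstrassCurve K) [V.IsElliptic]

omit [V.IsElliptic] in
/-- **Unpacking the Selmer condition of `Sel^{(m)}(E/K̄^H)`** (`selmerTorsionOver`) at a finite place `v` and a
conjugator `g ∈ Γ_K`: `conj_g x` dies in `H¹(H_{K_v}, E(K̄_v))` along the chosen embedding `K̄ → K̄_v`.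
[cite: PerrinRiou1987BSMF, §0 p. 401] -/
theorem localResTorsionOverOfEmb_conjH1_eq_zero_of_mem_selmerTorsionOver {m : ℤ}
    {H : Subgroup (absoluteGaloisGroup K)} [H.Normal] {x : V.torsionH1Over m H}
    (hx : x ∈ V.selmerTorsionOver H m) (v : HeightOneSpectrum (𝓞 K)) (g : absoluteGaloisGroup K) :
    V.localResTorsionOverOfEmb m H (closureEmb (K := K) (v.adicCompletion K))
      (Literature.NumberTheory.EllipticCurves.conjH1 H (geomTorsion V m) g x) = 0 := by
  have h := (AddSubgroup.mem_inf.1 hx).1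
  rw [AddSubgroup.mem_iInf] at h
  have h' := h v
  rw [AddSubgroup.mem_iInf] at h'
  exact (AddMonoidHom.mem_ker).1 (AddSubgroup.mem_comap.1 (h' g))

/-- **Silverman X.4.2(b), cocycle form, for a subgroup `H ≤ Γ_K`.** Let `v` be a finite place of good reduction
with `v ∤ m`, and `z` a continuous cocycle of `H` in `E[m]` whose class dies in `H¹(H_{K_v}, E(K̄_v))` (the local
Kummer/Selmer condition along the chosen `ι : K̄ → K̄_v`): `ι_* z(res x) = P^x - P` on `H_{K_v}` for some
`P ∈ E(K̄_v)`. Then for every `τ` in the inertia group `I_{K_v}` with `res τ ∈ H`: `m (P^τ - P) = O`, so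
`P^τ = P` (`smul_localPoints_eq_of_mem_inertia_holds`, via VIII.1.4) and `z(res τ) = 0` — the cocycle VANISHES there.
[cite: SilvermanAEC2009, X.§4 proof of Thm. 4.2(b), Cor. X.4.4] [cite: NeukirchANT1999, Ch. II (9.3)] -/
theorem cocycle_apply_eq_zero_of_localResTorsionOverOfEmb_eq_zero {m : ℤ}
    {H : Subgroup (absoluteGaloisGroup K)} {v : HeightOneSpectrum (𝓞 K)} (hv : v ∉ V.badPlaces (𝓞 K))
    (hmv : (m : 𝓞 K) ∉ v.asIdeal) (z : contOneCocycles (discreteTopRep H (geomTorsion V m)))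
    (hz : V.localResTorsionOverOfEmb m H (closureEmb (K := K) (v.adicCompletion K)) (oneCocycleClass _ z) = 0)
    {τ : absoluteGaloisGroup (v.adicCompletion K)} (hτI : τ ∈ absInertia (v.adicCompletion K))
    (hτ : absGaloisRestrict K (v.adicCompletion K) τ ∈ H) :
    z.1 ⟨absGaloisRestrict K (v.adicCompletion K) τ, hτ⟩ = 0 := by
  -- the local condition on cocycles: `ι_* z(res x) = x • P - P` on `H_{K_v}`
  obtain ⟨P, hP⟩ := (CocycleCriteria.resH1Hom_oneCocycleClass_eq_zero_iff _ _ _ z).1 hz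
  obtain ⟨𝔐, h𝔐⟩ := v.localPrimesAbove_nonempty
  obtain ⟨w, hw⟩ := v.exists_spectralValuation
  have hτ' : τ ∈ 𝔐.inertia (absoluteGaloisGroup (v.adicCompletion K)) := by
    rw [HeightOneSpectrum.inertia_eq_absInertia hw h𝔐]
    exact hτI
  -- `res τ ∈ H`, i.e. `τ` lies in the local subgroup `H_{K_v}` (`resGalOfEmb (closureEmb K_v) = absGaloisRestrict K K_v`)
  have hτloc : τ ∈ localSubgroupOfEmb H (closureEmb (K := K) (v.adicCompletion K)) := hτ
  have hT : pointsMapOfEmb V (closureEmb (K := K) (v.adicCompletion K))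
      ((z.1 ⟨absGaloisRestrict K (v.adicCompletion K) τ, hτ⟩ : geomTorsion V m) : geomPoints V) = τ • P - P :=
    hP ⟨τ, hτloc⟩
  -- `m • (τ • P - P) = 0`, hence `τ • P = P` by the reduction step
  have hm0 : m • ((z.1 ⟨absGaloisRestrict K (v.adicCompletion K) τ, hτ⟩ : geomTorsion V m) : geomPoints V) = 0 :=
    (Submodule.mem_torsionBy_iff m _).mp (z.1 _).2
  have hfix : τ • P = P := by
    refine V.smul_localPoints_eq_of_mem_inertia_holds v hv hmv h𝔐 hτ' ?_
    rw [← hT, ← map_zsmul, hm0, map_zero]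
  rw [hfix, sub_self] at hT
  exact Subtype.ext ((injective_iff_map_eq_zero _).mp (pointsMapOfEmb_injective V _) _ hT)

/-- **The Kummer class dies on `Γ_{(K_v)^{nr}} ×_{Γ_K} H`** (currency of the corestriction files): for a class
`y ∈ H¹(H, E[m])` satisfying the local condition at a good `v ∤ m`, the pull-back of `y` along the restricted pair
`(Γ_{(K_v)^{nr}} ×_{Γ_K} H → H, id_{E[m]})` (`comapRestrict`, `resPairHom`, `idPairHom` for
`unramifiedRestrictHom v : Γ_{(K_v)^{nr}} → Γ_K`) is `0` — a representative cocycle vanishes identically there,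
since `Γ_{(K_v)^{nr}} → Γ_{K_v}` lands in the inertia group. [cite: SilvermanAEC2009, Cor. X.4.4]
[cite: SerreLocalFields1979, Ch. IV §4 Cor. 2 to Prop. 16] -/
theorem map_comapRestrict_unramifiedRestrictHom_eq_zero {m : ℤ}
    {H : Subgroup (absoluteGaloisGroup K)} {v : HeightOneSpectrum (𝓞 K)} (hv : v ∉ V.badPlaces (𝓞 K))
    (hmv : (m : 𝓞 K) ∉ v.asIdeal) (y : V.torsionH1Over m H)
    (hy : V.localResTorsionOverOfEmb m H (closureEmb (K := K) (v.adicCompletion K)) y = 0) :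
    ContinuousCohomology.map (comapRestrict H (ZpExtension.unramifiedRestrictHom v))
        (resPairHom (V.torsionGaloisModule m).toTopRep
          (DiscreteGaloisModule.toTopRep
            (ContinuousRep.restrict (V.torsionGaloisModule m) (ZpExtension.unramifiedRestrictHom v)))
          (ZpExtension.unramifiedRestrictHom v)
          (ZpExtension.idPairHom (V.torsionGaloisModule m) (ZpExtension.unramifiedRestrictHom v)) H) 1 y = 0 := by
  obtain ⟨z, rfl⟩ := oneCocycleClass_surjective (subgroupRep (V.torsionGaloisModule m).toTopRep H) y
  -- `z`, read as a cocycle of the tree's `discreteTopRep H E[m]` (definitionally the same representation), vanishes at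
  -- `φ| h = res (res h) ∈ H` since `res h ∈ I_{K_v}` (§1)
  exact ZpExtension.map_comapRestrict_oneCocycleClass_eq_zero_of_forall_apply_eq_zero (V.torsionGaloisModule m)
    (ZpExtension.unramifiedRestrictHom v) H z fun h ↦
      V.cocycle_apply_eq_zero_of_localResTorsionOverOfEmb_eq_zero hv hmv
        (z : contOneCocycles (discreteTopRep H (geomTorsion V m))) hy
        (IsNonarchimedeanLocalField.absGaloisRestrict_maxUnramified_mem_absInertia (v.adicCompletion K)
          (h : absoluteGaloisGroup (IsNonarchimedeanLocalField.maxUnramified (v.adicCompletion K)))) h.2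

/-! ## §4 The components of `𝔖_p(K_∞)` and the control map are unramified at the good places `v ∤ p` -/

namespace LambdaAdicSelmerData

variable {V} {p : ℕ} [hp : Fact p.Prime] {κ : ZpExtension K p} {γ : absoluteGaloisGroup K}
  (D : V.LambdaAdicSelmerData κ γ)

omit [NumberField K] [V.IsElliptic] hp in
/-- `p^k ∉ v` for a finite place `v ∤ p`. [cite: NeukirchANT1999, Ch. I §8] -/
theorem intCast_pow_notMem {v : HeightOneSpectrum (𝓞 K)} (hpv : ((p : ℕ) : 𝓞 K) ∉ v.asIdeal) (k : ℕ) :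
    ((((p : ℤ) ^ k : ℤ)) : 𝓞 K) ∉ v.asIdeal := by
  rw [Int.cast_pow, Int.cast_natCast]
  exact fun h ↦ hpv (v.isPrime.mem_of_pow_mem k h)

/-- **Every conjugate of a component of `𝔖_p(K_∞)` dies on `Γ_{(K_v)^{nr}} ×_{Γ_K} Γ_n`** for a finite place
`v ∤ p` of good reduction: `D.proj n s k ∈ Sel^{(p^k)}(E/K_n)` (`proj_mem`) satisfies the local condition at `v`
for EVERY conjugate `g · (D.proj n s k)` (`selmerTorsionOver` quantifies over `σ ∈ Γ_K`), so §2 applies with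
`m = p^k`. This is the hypothesis of `ZpExtension.res_coresEisenstein_mem_unramifiedSubgroup` /
`pullback_coresEisenstein_eq_zero'` for `θ = D.proj n s k`. [cite: SilvermanAEC2009, Cor. X.4.4]
[cite: Howard2004HeegnerKolyvagin, §2.1 (F_𝔮 is unramified outside Σ) and Lemma 2.2.7] -/
theorem proj_conjMap_unramified {v : HeightOneSpectrum (𝓞 K)} (hv : v ∉ V.badPlaces (𝓞 K))
    (hpv : ((p : ℕ) : 𝓞 K) ∉ v.asIdeal) (n k : ℕ) (s : D.S) (g : absoluteGaloisGroup K) :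
    ContinuousCohomology.map (comapRestrict (κ.layerSubgroup n) (ZpExtension.unramifiedRestrictHom v))
        (resPairHom (V.torsionGaloisModule ((p : ℤ) ^ k)).toTopRep
          (DiscreteGaloisModule.toTopRep
            (ContinuousRep.restrict (V.torsionGaloisModule ((p : ℤ) ^ k)) (ZpExtension.unramifiedRestrictHom v)))
          (ZpExtension.unramifiedRestrictHom v)
          (ZpExtension.idPairHom (V.torsionGaloisModule ((p : ℤ) ^ k)) (ZpExtension.unramifiedRestrictHom v))
          (κ.layerSubgroup n)) 1
        (conjMap (V.torsionGaloisModule ((p : ℤ) ^ k)).toTopRep (κ.layerSubgroup n) g 1 (D.proj n s k)) = 0 := by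
  have hsel : D.proj n s k ∈ V.selmerTorsionOver (κ.layerSubgroup n) ((p : ℤ) ^ k) :=
    ((mem_compactSelmerOver_iff (W := V) (H := κ.layerSubgroup n) p (D.proj n s)).1 (D.proj_mem n s)).1 k
  -- `conjMap … g 1` is the tree's `conjH1 … g` on `torsionH1Over` (definitionally, `conjH1_geomTorsion_eq_conjMap`)
  exact V.map_comapRestrict_unramifiedRestrictHom_eq_zero hv (intCast_pow_notMem hpv k)
    (Literature.NumberTheory.EllipticCurves.conjH1 (κ.layerSubgroup n) (geomTorsion V ((p : ℤ) ^ k)) g (D.proj n s k))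
    (V.localResTorsionOverOfEmb_conjH1_eq_zero_of_mem_selmerTorsionOver hsel v g)

/-- **The level-`(n, k)` component `cor_{Γ_n}^{Γ_K} ((1 ⊗ ·)_* (D.proj n s k)) ∈ H¹(K, T_𝔮/p^k)` of an element of
`𝔖_p(K_∞)` is UNRAMIFIED at every finite place `v ∤ p` of good reduction**: its localisation at `v` lies in
`H¹_{ur}(K_v, T_𝔮/p^k) = unramifiedSubgroup (GaloisRep.toLocal v (κ⁻.eisensteinTwist E[p^k] hm k)) 1`
(`proj_conjMap_unramified` fed into the Mackey argument `ZpExtension.res_coresEisenstein_mem_unramifiedSubgroup`).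
[cite: Howard2004HeegnerKolyvagin, §2.1 and Lemma 2.2.7] [cite: NeukirchSchmidtWingberg2008, I §5 (1.5.6)–(1.5.7)] -/
theorem localization_eisensteinComponent_mem_unramifiedSubgroup {m : ℕ} (hm : 1 ≤ m) (k n : ℕ)
    (hn : eisensteinLevel (p := p) hm k ≤ n) (s : D.S) {v : HeightOneSpectrum (𝓞 K)}
    (hv : v ∉ V.badPlaces (𝓞 K)) (hpv : ((p : ℕ) : 𝓞 K) ∉ v.asIdeal) :
    galoisCohomology.localization
        ((κ.unitTwist (-1)).eisensteinTwist (V.torsionGaloisModule ((p : ℤ) ^ k)) hm k) (Sum.inr v) 1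
        (D.eisensteinComponent hm k n hn s) ∈
      unramifiedSubgroup
        (GaloisRep.toLocal v ((κ.unitTwist (-1)).eisensteinTwist (V.torsionGaloisModule ((p : ℤ) ^ k)) hm k)) 1 := by
  haveI := κ.fintypeQuotientLayer n
  rw [D.eisensteinComponent_apply hm k n hn s]
  exact (κ.unitTwist (-1)).res_coresEisenstein_mem_unramifiedSubgroup (V.torsionGaloisModule ((p : ℤ) ^ k)) hm k
    (κ.layerSubgroup n) (layerSubgroup_le_unitTwist_layerSubgroup hm hn) (κ.isOpen_layerSubgroup n) v
    (D.proj n s k) (fun g ↦ D.proj_conjMap_unramified hv hpv n k s g)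

section Linear

variable {m : ℕ} (hm : 1 ≤ m)
  (t : ∀ k, (V.torsionGaloisModule ((p : ℤ) ^ (k + 1))).toContRepresentation →ⁱL
    (V.torsionGaloisModule ((p : ℤ) ^ k)).toContRepresentation)
  (ht : ∀ k (P : geomTorsion V ((p : ℤ) ^ (k + 1))), t k P = V.geomTorsionReduce p k P)
  (I : ZpExtension.EisensteinH1Data (κ.unitTwist (-1)) (fun k ↦ V.torsionGaloisModule ((p : ℤ) ^ k)) t hm)

/-- **Howard's `(ur)` input for the image of `𝔖_p(K_∞)`.** For every `s ∈ 𝔖_p(K_∞)`, every `k` and every finite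
place `v` of good reduction with `v ∤ p`, the localisation at `v` of the `k`-th projection of
`toEisensteinH1Linear s ∈ H¹(K, T_𝔮)` (the pinned `lim_k H¹(K, T_𝔮/p^k)`) is unramified:
`loc_v (proj k (f s)) ∈ H¹_{ur}(K_v, T_𝔮/p^k)` — verbatim the hypothesis `hur` of
`ZpExtension.EisensteinH1Data.mem_ordinarySelmer_of_local` at the places outside `S ⊇ badPlaces`.
(Unconditional: the local–global inertia compatibility is not needed in this local-Galois-group currency.)
[cite: Howard2004HeegnerKolyvagin, §2.1 (F_𝔮 unramified outside Σ), §2.2 Lemma 2.2.7, Prop. 2.2.8]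
[cite: SilvermanAEC2009, Cor. X.4.4] -/
theorem localization_proj_toEisensteinH1Linear_mem_unramifiedSubgroup (hγ : κ.IsTopGenerator γ)
    (hE : ∀ P : V.toAffine.Point, p • P = 0 → P = 0) (s : D.S) (k : ℕ) {v : HeightOneSpectrum (𝓞 K)}
    (hv : v ∉ V.badPlaces (𝓞 K)) (hpv : ((p : ℕ) : 𝓞 K) ∉ v.asIdeal) :
    galoisCohomology.localization
        ((κ.unitTwist (-1)).eisensteinTwist (V.torsionGaloisModule ((p : ℤ) ^ k)) hm k) (Sum.inr v) 1
        (I.proj k (D.toEisensteinH1Linear hm t ht I hγ hE s)) ∈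
      unramifiedSubgroup
        (GaloisRep.toLocal v ((κ.unitTwist (-1)).eisensteinTwist (V.torsionGaloisModule ((p : ℤ) ^ k)) hm k)) 1 := by
  rw [D.proj_toEisensteinH1Linear hm t ht I hγ hE s k le_rfl]
  exact D.localization_eisensteinComponent_mem_unramifiedSubgroup hm k _ le_rfl s hv hpv

/-- **All finite places outside a finite set `S ⊇ badPlaces` at once** (the shape of `hur` in
`EisensteinH1Data.mem_ordinarySelmer_of_local`): for `h = toEisensteinH1Linear s`,
`∀ v ∉ S, v ∤ p → ∀ k, loc_v (proj k h) ∈ H¹_{ur}`. [cite: Howard2004HeegnerKolyvagin, §2.1 and Lemma 2.2.7] -/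
theorem toEisensteinH1Linear_hur (hγ : κ.IsTopGenerator γ) (hE : ∀ P : V.toAffine.Point, p • P = 0 → P = 0)
    (S : Finset (HeightOneSpectrum (𝓞 K))) (hS : ∀ v ∈ V.badPlaces (𝓞 K), v ∈ S) (s : D.S) :
    ∀ v ∉ S, ((p : ℕ) : 𝓞 K) ∉ v.asIdeal → ∀ k,
      galoisCohomology.localization
          ((κ.unitTwist (-1)).eisensteinTwist (V.torsionGaloisModule ((p : ℤ) ^ k)) hm k) (Sum.inr v) 1
          (I.proj k (D.toEisensteinH1Linear hm t ht I hγ hE s)) ∈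
        unramifiedSubgroup
          (GaloisRep.toLocal v ((κ.unitTwist (-1)).eisensteinTwist (V.torsionGaloisModule ((p : ℤ) ^ k)) hm k)) 1 :=
  fun v hvS hpv k ↦ D.localization_proj_toEisensteinH1Linear_mem_unramifiedSubgroup hm t ht I hγ hE s k
    (fun hv ↦ hvS (hS v hv)) hpv

end Linear

end LambdaAdicSelmerData

end WeierstrassCurve

end
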